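import Summits.CriticalPhenomena.SAWScalingLimit.Theorems.SAWDevelopingMapHexConjectureArcPhasesCut

/-!
# Arc phases of the reflex wedge, part 2: the phase bound

Support file for the crux `HexConjecture` (stmt-CriticalPhenomena-0808, Duminil-Copin–Smirnov 2012 Conjecture 1),
line `marginal-reflex-wedge-cauchy-kernel`, stub `stub_arcPhases` (part 1: `…ArcPhasesCut.lean`). Hopf's evaluation
of the winding of a walk of `W_N` from the corner mid-edge to an arc dart `(v, w)` (part 3) is
`W = arg(w̄ (c_w - c_v)) - arg(w̄ (c_w - o)) + arg(ō (o - c_w)) - π/3`, `o = c(cornerOut) = e^{iπ/6}/√3`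
(`w̄ = conj c_w`; the first two arguments come from the end sweep inside the disc of radius `‖c_w‖`, the third
from the start sweep with the cut along the bisector ray `{t·o : t ≥ 1}`). This part proves
(namespace `…MarginalWedge.ArcPhase`):
* `offCut_of_mem`, `offCut_outer` — the vertices of `W_N` and the outer vertex of an arc dart are off the cut
  (not `((a,a);t)` with `a ≥ 0`);
* `no_arcDart_cw`, `no_arcDart_ccw` — the two dart shapes that would violate the bound are the `60°`-ray and
  `0°`-ray families, whose two ends are equidistant from the apex, hence never arc darts (`‖c_v‖ < N ≤ ‖c_w‖`);
* **`arcPhase_bound`** (registered helper) — `-π ≤ arg(w̄ (c_w - c_v)) - arg(w̄ (c_w - o)) + arg(ō (o - c_w)) ≤ π`,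
  i.e. `W ∈ [-4π/3, 2π/3]`: with `q = ō c_w` one has `‖c_w‖² · ō(o - c_w) = -q · w̄(c_w - o)`, so the two chord
  arguments combine to `arg q ∓ π` according to the side of the bisector, and the bound reduces to
  `sign(arg(w̄(c_w - c_v)) + arg q) = sign(im q)`, whose failure exhibits one of the two excluded shapes.

Folklore plane geometry and lattice bookkeeping; no named fact is used.
-/

open scoped BigOperators Classical
open Literature.Probability.LatticeModels Literature.Probability.RandomPlanarGeometry
  Literature.Probability.RandomPlanarGeometry.SAW Literature.Probability.RandomPlanarGeometry.SAW.HV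

namespace Summit.CriticalPhenomena.SAWScalingLimit.Theorems.HexConjecture.MarginalWedge.ArcPhase

open ReflexGeometry

/-! ### Faces off the cut -/

/-- Vertices of `W_N` are off the cut: not of the form `((a,a);t)` with `a ≥ 0`. [folklore] -/
theorem offCut_of_mem {Λ : Finset HexVertex} {N : ℝ} (hW : IsReflexWedgeTruncation Λ N) {u : HexVertex}
    (hu : u ∈ Λ) : u.1 0 ≠ u.1 1 ∨ u.1 0 < 0 := by
  have h := ((mem_wedge_iff hW u).1 hu).2
  by_contra hc
  push Not at hc
  exact h ⟨hc.2, hc.1 ▸ hc.2⟩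

/-- **The outer vertex of an arc dart is off the cut**: a face `((a,a);t)`, `a ≥ 0`, adjacent to a vertex
of `W_N` is `cornerOut` (all other such faces have their three neighbours in the sector), which is within
radius `1 ≤ N`. [folklore] -/
theorem offCut_outer {Λ : Finset HexVertex} {N : ℝ} (hN : 1 ≤ N) (hW : IsReflexWedgeTruncation Λ N)
    {v w : HexVertex} (hv : v ∈ Λ) (hadj : hexGraph.Adj v w) (harc : IsArcDart N v w) :
    w.1 0 ≠ w.1 1 ∨ w.1 0 < 0 := by
  by_contra hc
  push Not at hc
  obtain ⟨h1, h2⟩ := hc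
  have hvq := ((mem_wedge_iff hW v).1 hv).2
  unfold IsArcDart at harc
  obtain ⟨x, t⟩ := v
  obtain ⟨a, b, rfl⟩ : ∃ a b : ℤ, x = ![a, b] := ⟨x 0, x 1, by funext j; fin_cases j <;> rfl⟩
  obtain ⟨y, t'⟩ := w
  obtain ⟨a', b', rfl⟩ : ∃ a' b' : ℤ, y = ![a', b'] := ⟨y 0, y 1, by funext j; fin_cases j <;> rfl⟩
  simp only [Matrix.cons_val_zero, Matrix.cons_val_one, Matrix.cons_val_fin_one] at h1 h2 hvq
  subst b'
  rw [hexGraph_adj_iff_coord] at hadj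
  simp only [Matrix.cons_val_zero, Matrix.cons_val_one, Matrix.cons_val_fin_one] at hadj
  have hlt : ‖hexCenter (((![(0 : ℤ), 0] : Site 2), (0 : Fin 2)) : HexVertex)‖ < N :=
    lt_of_lt_of_le norm_cornerOut_lt_one hN
  rcases hadj with ⟨-, -, hc⟩ | ⟨-, rfl, hc⟩
  · rcases hc with ⟨h3, h4⟩ | ⟨h3, h4⟩ | ⟨h3, h4⟩ <;> exact hvq ⟨by omega, by omega⟩
  · rcases hc with ⟨h3, h4⟩ | ⟨h3, h4⟩ | ⟨h3, h4⟩
    · exact hvq ⟨by omega, by omega⟩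
    · have ha' : a' = 0 := by omega
      subst ha'
      exact absurd harc (not_le.2 hlt)
    · have ha' : a' = 0 := by omega
      subst ha'
      exact absurd harc (not_le.2 hlt)

/-! ### The two dart shapes that would violate the phase bound do not occur on the arc -/

/-- The edge vector from `((a-1,b);1)` to `((a,b);0)` is `1/2 - i√3/6` (direction `-π/6`). [folklore] -/
theorem hexCenter_sub_cw (a b : ℤ) :
    hexCenter (((![a, b] : Site 2), (0 : Fin 2)) : HexVertex) - hexCenter (((![a - 1, b] : Site 2), (1 : Fin 2)) : HexVertex) =
      ((1 / 2 : ℝ) : ℂ) + ((-(Real.sqrt 3 / 6) : ℝ) : ℂ) * Complex.I := by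
  have h0 := two_mul_re_center a b 0
  have h1 := two_mul_re_center (a - 1) b 1
  apply Complex.ext
  · simp only [Complex.sub_re, Complex.add_re, Complex.ofReal_re, Complex.mul_re, Complex.I_re, Complex.ofReal_im,
      Complex.I_im, mul_zero, mul_one, sub_zero, add_zero]
    simp only [Fin.val_zero, Fin.val_one, Nat.cast_zero, Nat.cast_one] at h0 h1
    push_cast at h0 h1
    linarith
  · rw [Complex.sub_im, im_center_eq, im_center_eq]
    simp
    ring

/-- The edge vector from `((a,b-1);1)` to `((a,b);0)` is `i√3/3` (direction `π/2`). [folklore] -/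
theorem hexCenter_sub_ccw (a b : ℤ) :
    hexCenter (((![a, b] : Site 2), (0 : Fin 2)) : HexVertex) - hexCenter (((![a, b - 1] : Site 2), (1 : Fin 2)) : HexVertex) =
      ((Real.sqrt 3 / 3 : ℝ) : ℂ) * Complex.I := by
  have h0 := two_mul_re_center a b 0
  have h1 := two_mul_re_center a (b - 1) 1
  apply Complex.ext
  · simp only [Complex.sub_re, Complex.ofReal_re, Complex.mul_re, Complex.I_re, Complex.ofReal_im,
      Complex.I_im, mul_zero, mul_one, sub_zero]
    simp only [Fin.val_zero, Fin.val_one, Nat.cast_zero, Nat.cast_one] at h0 h1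
    push_cast at h0 h1
    linarith
  · rw [Complex.sub_im, im_center_eq, im_center_eq]
    simp
    ring

/-- **No arc dart of `W_N` points clockwise of the bisector (as seen in the frame `ō`) while its outer
vertex is counterclockwise of it**: such a dart is `((a-1,b);1) → ((a,b);0)` (direction `-π/6`) with
`b > a ≥ 0`, forcing `a = 0`, the `60°`-ray family, whose two ends are equidistant from the apex —
whereas an arc dart has `‖c_v‖ < N ≤ ‖c_w‖`. [folklore] -/
theorem no_arcDart_cw {Λ : Finset HexVertex} {N : ℝ} (hW : IsReflexWedgeTruncation Λ N) {v w : HexVertex}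
    (hv : v ∈ Λ) (harc : N ≤ ‖hexCenter w‖) (hadj : hexGraph.Adj v w)
    (hre : 0 < ((starRingEnd ℂ) (hexCenter cornerOut) * (hexCenter w - hexCenter v)).re)
    (him : ((starRingEnd ℂ) (hexCenter cornerOut) * (hexCenter w - hexCenter v)).im < 0)
    (he : 0 < ((starRingEnd ℂ) (hexCenter w) * (hexCenter w - hexCenter v)).re)
    (hq : 0 < ((starRingEnd ℂ) (hexCenter cornerOut) * hexCenter w).im) : False := by
  obtain ⟨hvN, hvq⟩ := (mem_wedge_iff hW v).1 hv
  obtain ⟨x, t⟩ := v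
  obtain ⟨a, b, rfl⟩ : ∃ a b : ℤ, x = ![a, b] := ⟨x 0, x 1, by funext j; fin_cases j <;> rfl⟩
  obtain ⟨y, t'⟩ := w
  obtain ⟨a', b', rfl⟩ : ∃ a' b' : ℤ, y = ![a', b'] := ⟨y 0, y 1, by funext j; fin_cases j <;> rfl⟩
  simp only [Matrix.cons_val_zero, Matrix.cons_val_one, Matrix.cons_val_fin_one] at hvq
  have hs3 : (0 : ℝ) < Real.sqrt 3 / 6 := by positivity
  rw [mul_sub, Complex.sub_re, re_conj_cornerOut_mul_center, re_conj_cornerOut_mul_center] at hre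
  rw [mul_sub, Complex.sub_im, im_conj_cornerOut_mul_center, im_conj_cornerOut_mul_center] at him
  rw [im_conj_cornerOut_mul_center] at hq
  rw [hexGraph_adj_iff_coord] at hadj
  simp only [Matrix.cons_val_zero, Matrix.cons_val_one, Matrix.cons_val_fin_one] at hadj
  rcases hadj with ⟨rfl, rfl, hc⟩ | ⟨rfl, rfl, hc⟩ <;>
    simp only [Fin.val_zero, Fin.val_one, Nat.cast_zero, Nat.cast_one] at hre him <;>
    rcases hc with ⟨h3, h4⟩ | ⟨h3, h4⟩ | ⟨h3, h4⟩
  · subst a' b'; nlinarith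
  · subst a' b'; push_cast at hre; nlinarith
  · subst a' b'; push_cast at hre; nlinarith
  · subst a b; nlinarith
  · -- the surviving shape `((a'-1,b');1) → ((a',b');0)`
    subst a b
    rw [hexCenter_sub_cw] at he
    have hre_w := two_mul_re_center a' b' 0
    rw [Complex.mul_re, Complex.conj_re, Complex.conj_im, Complex.add_re, Complex.add_im, Complex.ofReal_re,
      Complex.ofReal_im, Complex.mul_re, Complex.mul_im, Complex.ofReal_re, Complex.ofReal_im, Complex.I_re,
      Complex.I_im, im_center_eq] at he
    simp only [Fin.val_zero, Nat.cast_zero, add_zero, mul_zero, mul_one, zero_add, sub_self] at he hre_w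
    have h33 : Real.sqrt 3 * Real.sqrt 3 = 3 := Real.mul_self_sqrt (by norm_num)
    have hre_w' : (hexCenter (((![a', b'] : Site 2), (0 : Fin 2)) : HexVertex)).re = (2 * a' + b' + 1) / 2 := by
      linarith
    -- `he : (3a'+1)/6 > 0`
    have hE : (hexCenter (((![a', b'] : Site 2), (0 : Fin 2)) : HexVertex)).re * (1 / 2) -
        -((3 * (b' : ℝ) + 1) * (Real.sqrt 3 / 6)) * -(Real.sqrt 3 / 6) = (3 * a' + 1) / 6 := by
      rw [hre_w']
      linear_combination (-(3 * (b' : ℝ) + 1) / 36) * h33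
    rw [hE] at he
    have ha0 : (-1 : ℝ) < 3 * a' := by linarith
    have ha0' : 0 ≤ a' := by
      have : (-1 : ℤ) < 3 * a' := by exact_mod_cast ha0
      omega
    have hba : (a' : ℝ) < b' := by nlinarith
    have hba' : a' < b' := by exact_mod_cast hba
    have ha : a' = 0 := by omega
    subst ha
    have hle : ‖hexCenter (((![(0 : ℤ), b'] : Site 2), (0 : Fin 2)) : HexVertex)‖ ≤
        ‖hexCenter (((![(0 : ℤ) - 1, b'] : Site 2), (1 : Fin 2)) : HexVertex)‖ := by
      rw [norm_center_le_iff]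
      simp only [Fin.val_zero, Fin.val_one, Nat.cast_zero, Nat.cast_one]
      nlinarith
    linarith
  · subst a b; push_cast at him; nlinarith

/-- **Mirror image**: no arc dart points counterclockwise of the bisector while its outer vertex is
clockwise of it — such a dart is the vertical `((a,b-1);1) → ((a,b);0)` with `a > b ≥ 0`, forcing
`b = 0`, the `0°`-ray family, again with equidistant ends. [folklore] -/
theorem no_arcDart_ccw {Λ : Finset HexVertex} {N : ℝ} (hW : IsReflexWedgeTruncation Λ N) {v w : HexVertex}
    (hv : v ∈ Λ) (harc : N ≤ ‖hexCenter w‖) (hadj : hexGraph.Adj v w)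
    (hre : 0 < ((starRingEnd ℂ) (hexCenter cornerOut) * (hexCenter w - hexCenter v)).re)
    (him : 0 < ((starRingEnd ℂ) (hexCenter cornerOut) * (hexCenter w - hexCenter v)).im)
    (he : 0 < ((starRingEnd ℂ) (hexCenter w) * (hexCenter w - hexCenter v)).re)
    (hq : ((starRingEnd ℂ) (hexCenter cornerOut) * hexCenter w).im < 0) : False := by
  obtain ⟨hvN, hvq⟩ := (mem_wedge_iff hW v).1 hv
  obtain ⟨x, t⟩ := v
  obtain ⟨a, b, rfl⟩ : ∃ a b : ℤ, x = ![a, b] := ⟨x 0, x 1, by funext j; fin_cases j <;> rfl⟩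
  obtain ⟨y, t'⟩ := w
  obtain ⟨a', b', rfl⟩ : ∃ a' b' : ℤ, y = ![a', b'] := ⟨y 0, y 1, by funext j; fin_cases j <;> rfl⟩
  simp only [Matrix.cons_val_zero, Matrix.cons_val_one, Matrix.cons_val_fin_one] at hvq
  have hs3 : (0 : ℝ) < Real.sqrt 3 / 6 := by positivity
  rw [mul_sub, Complex.sub_re, re_conj_cornerOut_mul_center, re_conj_cornerOut_mul_center] at hre
  rw [mul_sub, Complex.sub_im, im_conj_cornerOut_mul_center, im_conj_cornerOut_mul_center] at him
  rw [im_conj_cornerOut_mul_center] at hq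
  rw [hexGraph_adj_iff_coord] at hadj
  simp only [Matrix.cons_val_zero, Matrix.cons_val_one, Matrix.cons_val_fin_one] at hadj
  rcases hadj with ⟨rfl, rfl, hc⟩ | ⟨rfl, rfl, hc⟩ <;>
    simp only [Fin.val_zero, Fin.val_one, Nat.cast_zero, Nat.cast_one] at hre him <;>
    rcases hc with ⟨h3, h4⟩ | ⟨h3, h4⟩ | ⟨h3, h4⟩
  · subst a' b'; nlinarith
  · subst a' b'; push_cast at hre; nlinarith
  · subst a' b'; push_cast at hre; nlinarith
  · subst a b; nlinarith
  · subst a b; push_cast at him; nlinarith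
  · -- the surviving shape `((a',b'-1);1) → ((a',b');0)`
    subst a b
    rw [hexCenter_sub_ccw] at he
    rw [Complex.mul_re, Complex.conj_re, Complex.conj_im, Complex.mul_re, Complex.mul_im, Complex.ofReal_re,
      Complex.ofReal_im, Complex.I_re, Complex.I_im, im_center_eq] at he
    simp only [Fin.val_zero, Nat.cast_zero, add_zero, mul_zero, mul_one, sub_self, zero_sub] at he
    have h33 : Real.sqrt 3 * Real.sqrt 3 = 3 := Real.mul_self_sqrt (by norm_num)
    -- `he : (3b'+1)/6 > 0`
    have hE : -(-((3 * (b' : ℝ) + 1) * (Real.sqrt 3 / 6)) * (Real.sqrt 3 / 3)) = (3 * b' + 1) / 6 := by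
      linear_combination ((3 * (b' : ℝ) + 1) / 18) * h33
    rw [hE] at he
    have hb0 : (-1 : ℝ) < 3 * b' := by linarith
    have hb0' : 0 ≤ b' := by
      have : (-1 : ℤ) < 3 * b' := by exact_mod_cast hb0
      omega
    have hba : (b' : ℝ) < a' := by nlinarith
    have hba' : b' < a' := by exact_mod_cast hba
    have hb : b' = 0 := by omega
    subst hb
    have hle : ‖hexCenter (((![a', (0 : ℤ)] : Site 2), (0 : Fin 2)) : HexVertex)‖ ≤
        ‖hexCenter (((![a', (0 : ℤ) - 1] : Site 2), (1 : Fin 2)) : HexVertex)‖ := by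
      rw [norm_center_le_iff]
      simp only [Fin.val_zero, Fin.val_one, Nat.cast_zero, Nat.cast_one]
      nlinarith
    linarith

/-- A face off the cut lying on the bisector line lies on the opposite ray: `re (ō c) < 0`. [folklore] -/
theorem re_conj_cornerOut_mul_neg {u : HexVertex} (hoff : u.1 0 ≠ u.1 1 ∨ u.1 0 < 0)
    (him : ((starRingEnd ℂ) (hexCenter cornerOut) * hexCenter u).im = 0) :
    ((starRingEnd ℂ) (hexCenter cornerOut) * hexCenter u).re < 0 := by
  obtain ⟨x, t⟩ := u
  obtain ⟨a, b, rfl⟩ : ∃ a b : ℤ, x = ![a, b] := ⟨x 0, x 1, by funext j; fin_cases j <;> rfl⟩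
  simp only [Matrix.cons_val_zero, Matrix.cons_val_one, Matrix.cons_val_fin_one] at hoff
  rw [im_conj_cornerOut_mul_center] at him
  rw [re_conj_cornerOut_mul_center]
  have hs3 : (0 : ℝ) < Real.sqrt 3 / 6 := by positivity
  have hab : a = b := by
    have h := (mul_eq_zero.1 him).resolve_right hs3.ne'
    exact_mod_cast (show (a : ℝ) = b by linarith)
  have ha : a < 0 := hoff.resolve_left (fun h => h hab)
  subst hab
  have ha' : (a : ℝ) ≤ -1 := by exact_mod_cast (show a ≤ -1 by omega)
  have ht : (((t : ℕ) : ℝ)) ≤ 1 := by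
    have : (t : ℕ) ≤ 1 := by omega
    exact_mod_cast this
  have : (3 * (a : ℝ) + 3 * a + 2 * ((t : ℕ) : ℝ) + 2) < 0 := by linarith
  exact div_neg_of_neg_of_pos this (by norm_num)

/-- **The phase bound.** For an arc dart `(v, w)` of `W_N` the combination
`arg(w̄(w - v)) - arg(w̄(w - o)) + arg(ō(o - w))` of the three arguments entering Hopf's evaluation of
the winding lies in `[-π, π]`. With `q = ō w`: `ō(o - w)·‖w‖² = -q · w̄(w - o)`, so the last two terms
combine to `arg q ∓ π` according to the side of the bisector (`sign im q`), and the bound reduces to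
`sign(arg(w̄(w - v)) + arg q) = sign(im q)`, whose failure would exhibit one of the two excluded dart
shapes (`no_arcDart_cw`, `no_arcDart_ccw`). Registered helper `arcPhase_bound` of the stub `stub_arcPhases`.
[folklore] -/
theorem arcPhase_bound : ∀ {Λ : Finset HexVertex} {N : ℝ}, 1 ≤ N → IsReflexWedgeTruncation Λ N → ∀ {v w : HexVertex}, v ∈ Λ → hexGraph.Adj v w → IsArcDart N v w → -Real.pi ≤ Complex.arg ((starRingEnd ℂ) (hexCenter w) * (hexCenter w - hexCenter v)) - Complex.arg ((starRingEnd ℂ) (hexCenter w) * (hexCenter w - hexCenter cornerOut)) + Complex.arg ((starRingEnd ℂ) (hexCenter cornerOut) * (hexCenter cornerOut - hexCenter w)) ∧ Complex.arg ((starRingEnd ℂ) (hexCenter w) * (hexCenter w - hexCenter v)) - Complex.arg ((starRingEnd ℂ) (hexCenter w) * (hexCenter w - hexCenter cornerOut)) + Complex.arg ((starRingEnd ℂ) (hexCenter cornerOut) * (hexCenter cornerOut - hexCenter w)) ≤ Real.pi := by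
  intro Λ N hN hW v w hv hadj harc
  have harc' : N ≤ ‖hexCenter w‖ := harc
  have hoff := offCut_outer hN hW hv hadj harc
  set p := hexCenter w with hp
  set o := hexCenter cornerOut with ho
  set cv := hexCenter v with hcv
  set e := (starRingEnd ℂ) p * (p - cv) with he_def
  set Z := (starRingEnd ℂ) p * (p - o) with hZ_def
  set Y := (starRingEnd ℂ) o * (o - p) with hY_def
  set q := (starRingEnd ℂ) o * p with hq_def
  have hvN : ‖cv‖ < N := ((hW v).1 hv).1
  have he : 0 < e.re := re_conj_mul_sub_pos (lt_of_lt_of_le hvN harc')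
  have hZ : 0 < Z.re := re_conj_mul_sub_pos (by linarith [norm_cornerOut_lt_one])
  have he0 : e ≠ 0 := fun h => by rw [h] at he; simp at he
  have hZ0 : Z ≠ 0 := fun h => by rw [h] at hZ; simp at hZ
  have hp0 : p ≠ 0 := norm_pos_iff.1 (by linarith)
  have ho0 : o ≠ 0 := cornerOut_ne_zero
  have hq0 : q ≠ 0 := mul_ne_zero ((map_ne_zero _).2 ho0) hp0
  have hnp : 0 < Complex.normSq p := Complex.normSq_pos.2 hp0
  have hYZ : ((Complex.normSq p : ℝ) : ℂ) * Y = -(q * Z) := by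
    rw [Complex.normSq_eq_conj_mul_self]
    simp only [hY_def, hZ_def, hq_def]
    ring
  have hargY : Complex.arg Y = Complex.arg (-q * Z) := by
    have : Y = (((Complex.normSq p)⁻¹ : ℝ) : ℂ) * (-q * Z) := by
      rw [neg_mul, ← hYZ, ← mul_assoc, ← Complex.ofReal_mul, inv_mul_cancel₀ hnp.ne', Complex.ofReal_one, one_mul]
    rw [this, Complex.arg_real_mul _ (inv_pos.2 hnp)]
  have hZim : Z.im = q.im := by
    simp only [hZ_def, hq_def, Complex.mul_im, Complex.conj_re, Complex.conj_im, Complex.sub_im, Complex.sub_re]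
    ring
  have heq : e * q = ((Complex.normSq p : ℝ) : ℂ) * ((starRingEnd ℂ) o * (p - cv)) := by
    rw [Complex.normSq_eq_conj_mul_self]
    simp only [he_def, hq_def]
    ring
  obtain ⟨he1, he2⟩ := abs_lt.1 (Complex.abs_arg_lt_pi_div_two_iff.2 (Or.inl he))
  obtain ⟨hZ1, hZ2⟩ := abs_lt.1 (Complex.abs_arg_lt_pi_div_two_iff.2 (Or.inl hZ))
  have hqπ := Complex.arg_le_pi q
  have hqπ' := Complex.neg_pi_lt_arg q
  rcases lt_trichotomy q.im 0 with hqi | hqi | hqi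
  · -- `w` clockwise of the bisector
    have hargq : Complex.arg q < 0 := Complex.arg_neg_iff.2 hqi
    have hZneg : Complex.arg Z < 0 := Complex.arg_neg_iff.2 (hZim ▸ hqi)
    have h1 : Complex.arg (-q * Z) = Complex.arg q + Real.pi + Complex.arg Z := by
      rw [(Complex.arg_mul_eq_add_arg_iff (neg_ne_zero.2 hq0) hZ0).2, Complex.arg_neg_eq_arg_add_pi_of_im_neg hqi]
      rw [Complex.arg_neg_eq_arg_add_pi_of_im_neg hqi]
      constructor <;> linarith
    rw [hargY, h1]
    suffices hs : Complex.arg e + Complex.arg q ≤ 0 by constructor <;> linarith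
    by_contra hcon
    push Not at hcon
    have hsum : Complex.arg (e * q) = Complex.arg e + Complex.arg q :=
      (Complex.arg_mul_eq_add_arg_iff he0 hq0).2 ⟨by linarith, by linarith⟩
    have him : 0 < (e * q).im := by
      -- `0 < arg (e q) < π` forces `im (e q) > 0`
      rcases lt_trichotomy (e * q).im 0 with h | h | h
      · have := Complex.arg_neg_iff.2 h
        linarith
      · exfalso
        rcases le_or_gt 0 (e * q).re with hr | hr
        · have := Complex.arg_eq_zero_iff.2 ⟨hr, h⟩
          linarith
        · have := Complex.arg_eq_pi_iff.2 ⟨hr, h⟩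
          linarith
      · exact h
    have hre : 0 < (e * q).re := by
      have habs : |Complex.arg (e * q)| < Real.pi / 2 := by
        rw [hsum, abs_lt]
        constructor <;> linarith
      rcases Complex.abs_arg_lt_pi_div_two_iff.1 habs with h | h
      · exact h
      · exact absurd h (mul_ne_zero he0 hq0)
    rw [heq, Complex.re_ofReal_mul] at hre
    rw [heq, Complex.im_ofReal_mul] at him
    exact no_arcDart_ccw hW hv harc' hadj (pos_of_mul_pos_right hre hnp.le) (pos_of_mul_pos_right him hnp.le) he hqi
  · -- `w` on the bisector line: then on the opposite ray, `q < 0`, and the two chord terms cancel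
    have hqre : q.re < 0 := re_conj_cornerOut_mul_neg hoff hqi
    have hq' : -q = ((-q.re : ℝ) : ℂ) := by
      apply Complex.ext <;> simp [hqi]
    rw [hargY, hq', Complex.arg_real_mul _ (by linarith)]
    constructor <;> linarith [Real.pi_pos]
  · -- `w` counterclockwise of the bisector
    have hargq : 0 < Complex.arg q := by
      rcases lt_or_eq_of_le (Complex.arg_nonneg_iff.2 hqi.le) with h' | h'
      · exact h'
      · exact absurd (Complex.arg_eq_zero_iff.1 h'.symm).2 hqi.ne'
    have hZpos : 0 ≤ Complex.arg Z := Complex.arg_nonneg_iff.2 (hZim ▸ hqi.le)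
    have h1 : Complex.arg (-q * Z) = Complex.arg q - Real.pi + Complex.arg Z := by
      rw [(Complex.arg_mul_eq_add_arg_iff (neg_ne_zero.2 hq0) hZ0).2, Complex.arg_neg_eq_arg_sub_pi_of_im_pos hqi]
      rw [Complex.arg_neg_eq_arg_sub_pi_of_im_pos hqi]
      constructor <;> linarith
    rw [hargY, h1]
    suffices hs : 0 ≤ Complex.arg e + Complex.arg q by constructor <;> linarith
    by_contra hcon
    push Not at hcon
    have hsum : Complex.arg (e * q) = Complex.arg e + Complex.arg q :=
      (Complex.arg_mul_eq_add_arg_iff he0 hq0).2 ⟨by linarith, by linarith⟩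
    have him : (e * q).im < 0 := Complex.arg_neg_iff.1 (by linarith)
    have hre : 0 < (e * q).re := by
      have habs : |Complex.arg (e * q)| < Real.pi / 2 := by
        rw [hsum, abs_lt]
        constructor <;> linarith
      rcases Complex.abs_arg_lt_pi_div_two_iff.1 habs with h | h
      · exact h
      · exact absurd h (mul_ne_zero he0 hq0)
    rw [heq, Complex.re_ofReal_mul] at hre
    rw [heq, Complex.im_ofReal_mul] at him
    refine no_arcDart_cw hW hv harc' hadj (pos_of_mul_pos_right hre hnp.le) ?_ he hqi
    by_contra h
    push Not at h
    have := mul_nonneg hnp.le h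
    linarith

end Summit.CriticalPhenomena.SAWScalingLimit.Theorems.HexConjecture.MarginalWedge.ArcPhase
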